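import Literature.NumberTheory.NumberFields.QuadraticSplitPrimeConjugateTwister
import Literature.NumberTheory.NumberFields.RayTwisterCongruences
import HarnessLib

/-!
# The twister PAIR `(α_m, σα_m)` of de Shalit II.4.12 at the split prime `2 = 𝔭𝔭̄` of an imaginary
# quadratic field, at every level `m` — all σ-side inputs of the division/gluing step by name

De Shalit II.4.12 (p. 66–68) with II.4.17 (p. 77–78: `p = 2`, the group `1 + 4ℤ₂`): at level `m` (modulus
`𝔣_m = 𝔤^{m+1} 𝔭̄^{m+1}`) the pseudo-measure is divided by `δ_𝔞 = σ_𝔞 − N𝔞` for `𝔞 = (α)`, `𝔞̄ = (σα)`,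
`α ≡ 1 (mod 𝔣_m)`, `σ_𝔞` a topological generator of `Gal(K(𝔣_m𝔭^∞)/K(𝔣_m𝔭^{m+2}))`. The tree's division and
gluing theorems (`GroupDistribution.exists_twisting_μ_eq_of_cocycle_natCast` p704309,
`exists_glue_twisting_μ_eq_forall_seriesFamily` p729700) take, per level, two twisters with: membership at
tower level `s = m+1` (`hσ₁ hσ₂`), generation (`hgen`, discharged by `hgen_artin` from
`α − 1 ∈ 𝔭^{s+1} ∖ 𝔭^{s+2}`), `2 ≤ N`, `4 ∣ N − 1`, equal norms (`hN12`) and independence (`hτ`, discharged by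
`hτ_artin` from `(σα)^k ≠ α^k` in `K_𝔭`). THIS FILE produces, for `K` imaginary quadratic with `(𝓞 K)ˣ = {±1}`,
`(2) = 𝔭_v 𝔭_v̄`, `v̄ ≠ v`, `σ • 𝔭_v = 𝔭_v̄`, and an ideal `𝔤` prime to `2`, at every `m`:

* ★ `exists_twisterPair` — **`α ∈ 𝓞 K` with `α, σα ≡ 1 (mod 𝔤^{m+1}𝔭_v̄^{m+1})`, `α − 1 ∈ 𝔭_v^{m+2} ∖ 𝔭_v^{m+3}`,
  `σα − 1 ∈ 𝔭_v^{m+2}`, `N(σα) = N(α) > 0`, `4 ∣ N(α) − 1`, `2 ≤ N((α))`, and `(σα)^k ≠ α^k` in `K_v`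
  for all `k > 0`** (plus `α, σα ≠ 0`, `∉ 𝔭_v`).

Ingredients: `exists_sub_one_mem_and_mem_pow_not_mem_pow_succ'` (CRT with `𝔞 = 𝔤^{m+1}(σ𝔤)^{m+1}𝔭_v̄^{m+3}`),
`sub_one_mem_smul_iff`, `norm_smul_eq`, `norm_pos_of_ne_zero`, `Int.dvd_norm_sub_one_of_sub_one_mem_span`
(`α ≡ 1 (mod (𝔭_v𝔭_v̄)² = (4))`), `pow_smul_ne_pow`. Theorems only; no `sorry`.

## References
* [deShalit1987] E. de Shalit, *Iwasawa theory of elliptic curves with complex multiplication* (1987),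
  II.4.12 (p. 66–68), II.4.14 Step 1 (p. 71), II.4.17 (p. 77–78).
* [NeukirchANT1999] J. Neukirch, *Algebraic Number Theory* (1999), Ch. I §3 (3.6), §9 (9.1).
-/

noncomputable section

open NumberField IsDedekindDomain
open scoped Pointwise

namespace Literature.NumberTheory.NumberFields

variable {K : Type} [Field K] [NumberField K]

/-! ### §1. Small lemmas at a split `2 = 𝔭𝔭̄` -/

/-- `2 ∉ 𝔭_v²` when `(2) = 𝔭_v 𝔭_v̄` with `𝔭_v̄ ≠ 𝔭_v` (`v` is unramified). [cite: NeukirchANT1999, Ch. I §8 (8.2)] -/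
theorem two_not_mem_sq_of_span_eq_mul {v vbar : HeightOneSpectrum (𝓞 K)}
    (h2 : Ideal.span {(2 : 𝓞 K)} = v.asIdeal * vbar.asIdeal) (hne : vbar ≠ v) :
    (2 : 𝓞 K) ∉ v.asIdeal ^ 2 := by
  intro h
  have hle : v.asIdeal * vbar.asIdeal ≤ v.asIdeal ^ 2 := by
    rw [← h2, Ideal.span_singleton_le_iff_mem]; exact h
  rw [← Ideal.dvd_iff_le, pow_two, mul_dvd_mul_iff_left v.ne_bot, Ideal.dvd_iff_le] at hle
  exact hne (HeightOneSpectrum.ext (vbar.isMaximal.eq_of_le v.isPrime.ne_top hle))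

/-- `(𝔭_v 𝔭_v̄)² = (4)` when `(2) = 𝔭_v𝔭_v̄`, membership form: `x ∈ 𝔭_v² ∩ 𝔭_v̄² ⟹ x ∈ (4)`.
[cite: NeukirchANT1999, Ch. I §3 (3.6)] -/
theorem mem_span_four_of_mem_sq_of_mem_sq {v vbar : HeightOneSpectrum (𝓞 K)}
    (h2 : Ideal.span {(2 : 𝓞 K)} = v.asIdeal * vbar.asIdeal) (hne : vbar ≠ v) {x : 𝓞 K}
    (hv : x ∈ v.asIdeal ^ 2) (hvbar : x ∈ vbar.asIdeal ^ 2) : x ∈ Ideal.span {((4 : ℤ) : 𝓞 K)} := by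
  have hcop : v.asIdeal ^ 2 ⊔ vbar.asIdeal ^ 2 = ⊤ :=
    Ideal.pow_sup_eq_top (Ideal.sup_pow_eq_top (v.isMaximal.coprime_of_ne vbar.isMaximal
      (fun h ↦ hne (HeightOneSpectrum.ext h.symm))))
  have hmem : x ∈ v.asIdeal ^ 2 * vbar.asIdeal ^ 2 := by
    rw [Ideal.mul_eq_inf_of_coprime hcop]; exact ⟨hv, hvbar⟩
  rw [← mul_pow, ← h2, Ideal.span_singleton_pow] at hmem
  convert hmem using 2
  norm_num

/-! ### §2. The twister pair -/

/-- ★ **The twister pair `(α, σα)` at level `m`** (de Shalit II.4.12's `𝔞 = (α)`, `𝔞̄ = (σα)` at `p = 2`): for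
`K` quadratic and totally complex with `(𝓞 K)ˣ = {±1}`, `(2) = 𝔭_v𝔭_v̄`, `𝔭_v̄ ≠ 𝔭_v`, `σ ∈ Aut(K/ℚ)` with
`σ • 𝔭_v = 𝔭_v̄`, and `𝔤` prime to `𝔭_v, 𝔭_v̄`, there is `α ∈ 𝓞 K` with: `α ≠ 0`, `α ∉ 𝔭_v`, `σα ≠ 0`, `σα ∉ 𝔭_v`;
`α − 1, σα − 1 ∈ 𝔤^{m+1} 𝔭_v̄^{m+1}` (both Artin symbols lie in `Gal(K̄/K(𝔣_m))`); `α − 1 ∈ 𝔭_v^{m+2} ∖ 𝔭_v^{m+3}`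
(generation at tower level `s = m+1`: `hgen_artin`), `σα − 1 ∈ 𝔭_v^{m+2}` (`hσ₂`); `N(σα) = N(α) > 0`,
`4 ∣ N(α) − 1`, `2 ≤ N((α))` (`hN12`, `h4`, `hN1`); and `(σα)^k ≠ α^k` in `K_v` for every `k > 0` (`hτ_artin`).
[cite: deShalit1987, II.4.12 (p. 66–68), II.4.17 (p. 77–78)] [cite: NeukirchANT1999, Ch. I §3 (3.6), §9 (9.1)] -/
theorem exists_twisterPair (hK2 : Module.finrank ℚ K = 2) [IsTotallyComplex K]
    (hunits : Nat.card (𝓞 K)ˣ = 2) {v vbar : HeightOneSpectrum (𝓞 K)}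
    (h2 : Ideal.span {(2 : 𝓞 K)} = v.asIdeal * vbar.asIdeal) (hne : vbar ≠ v)
    {σ : K ≃ₐ[ℚ] K} (hσ : σ • v.asIdeal = vbar.asIdeal) {𝔤 : Ideal (𝓞 K)}
    (h𝔤v : ¬ 𝔤 ≤ v.asIdeal) (h𝔤vbar : ¬ 𝔤 ≤ vbar.asIdeal) (m : ℕ) :
    ∃ α : 𝓞 K, α ≠ 0 ∧ α ∉ v.asIdeal ∧ σ • α ≠ 0 ∧ σ • α ∉ v.asIdeal ∧
      α - 1 ∈ 𝔤 ^ (m + 1) * vbar.asIdeal ^ (m + 1) ∧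
      σ • α - 1 ∈ 𝔤 ^ (m + 1) * vbar.asIdeal ^ (m + 1) ∧
      α - 1 ∈ v.asIdeal ^ (m + 2) ∧ α - 1 ∉ v.asIdeal ^ (m + 3) ∧ σ • α - 1 ∈ v.asIdeal ^ (m + 2) ∧
      Algebra.norm ℤ (σ • α) = Algebra.norm ℤ α ∧ 0 < Algebra.norm ℤ α ∧
      (4 : ℤ) ∣ Algebra.norm ℤ α - 1 ∧ 2 ≤ Ideal.absNorm (Ideal.span {α}) ∧
      ∀ k : ℕ, 0 < k →
        (((σ • α : 𝓞 K) : K) : v.adicCompletion K) ^ k ≠ (((α : 𝓞 K) : K) : v.adicCompletion K) ^ k := by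
  obtain ⟨hσ1, hσσ, hσ'⟩ := algEquiv_swap_spec hK2 hne hσ
  have h2v : (2 : 𝓞 K) ∉ v.asIdeal ^ 2 := two_not_mem_sq_of_span_eq_mul h2 hne
  -- the CRT ideal `𝔞 = 𝔤^{m+1} (σ𝔤)^{m+1} 𝔭_v̄^{m+3}` is prime to `𝔭_v`
  set 𝔞 : Ideal (𝓞 K) := 𝔤 ^ (m + 1) * (σ • 𝔤) ^ (m + 1) * vbar.asIdeal ^ (m + 3) with h𝔞
  have hσ𝔤v : ¬ σ • 𝔤 ≤ v.asIdeal := fun h ↦ h𝔤vbar (by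
    have h' := Ideal.pointwise_smul_le_pointwise_smul_iff (a := σ) |>.mpr h
    rwa [smul_smul, hσσ, one_smul, hσ] at h')
  have h𝔞v : ¬ 𝔞 ≤ v.asIdeal := by
    intro h
    rcases (v.isPrime.mul_le.mp h) with h | h
    · rcases (v.isPrime.mul_le.mp h) with h | h
      · exact h𝔤v ((Ideal.IsPrime.pow_le_iff (I := 𝔤) (by omega)).mp h)
      · exact hσ𝔤v ((Ideal.IsPrime.pow_le_iff (I := σ • 𝔤) (by omega)).mp h)
    · exact hne (HeightOneSpectrum.ext (vbar.isMaximal.eq_of_le v.isPrime.ne_top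
        ((Ideal.IsPrime.pow_le_iff (I := vbar.asIdeal) (by omega)).mp h)))
  obtain ⟨α, hα0, hαv, hα𝔞, hαn, hαn'⟩ :=
    exists_sub_one_mem_and_mem_pow_not_mem_pow_succ' h𝔞v (m + 2) (by omega)
  -- unpack the congruences of `α`
  have hα𝔤 : α - 1 ∈ 𝔤 ^ (m + 1) := Ideal.mul_le_right (Ideal.mul_le_right hα𝔞)
  have hασ𝔤 : α - 1 ∈ (σ • 𝔤) ^ (m + 1) := Ideal.mul_le_left (I := 𝔤 ^ (m + 1)) (Ideal.mul_le_right hα𝔞)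
  have hαvbar : α - 1 ∈ vbar.asIdeal ^ (m + 3) := Ideal.mul_le_left hα𝔞
  -- the congruences of `σα`
  have hσα𝔤 : σ • α - 1 ∈ 𝔤 ^ (m + 1) := by
    have h := (sub_one_mem_smul_pow_iff σ (σ • 𝔤) (m + 1) α).mpr hασ𝔤
    rwa [smul_smul, hσσ, one_smul] at h
  have hσαv : σ • α - 1 ∈ v.asIdeal ^ (m + 3) := by
    have h := (sub_one_mem_smul_pow_iff σ vbar.asIdeal (m + 3) α).mpr hαvbar
    rwa [hσ'] at h
  have hσαvbar : σ • α - 1 ∈ vbar.asIdeal ^ (m + 2) := by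
    have h := (sub_one_mem_smul_pow_iff σ v.asIdeal (m + 2) α).mpr hαn
    rwa [hσ] at h
  -- coprimality `𝔤^{m+1} + 𝔭_v̄^{m+1} = 1`
  have hcop : 𝔤 ^ (m + 1) ⊔ vbar.asIdeal ^ (m + 1) = ⊤ :=
    Ideal.pow_sup_eq_top (sup_pow_eq_top_of_not_le h𝔤vbar (m + 1))
  have hmem𝔣 : ∀ x : 𝓞 K, x ∈ 𝔤 ^ (m + 1) → x ∈ vbar.asIdeal ^ (m + 1) →
      x ∈ 𝔤 ^ (m + 1) * vbar.asIdeal ^ (m + 1) := fun x hx hx' ↦ by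
    rw [Ideal.mul_eq_inf_of_coprime hcop]; exact ⟨hx, hx'⟩
  -- norms
  have hN : Algebra.norm ℤ (σ • α) = Algebra.norm ℤ α := norm_smul_eq σ α
  have hpos : 0 < Algebra.norm ℤ α := norm_pos_of_ne_zero hK2 hα0
  have h4 : (4 : ℤ) ∣ Algebra.norm ℤ α - 1 :=
    Int.dvd_norm_sub_one_of_sub_one_mem_span 4 (mem_span_four_of_mem_sq_of_mem_sq h2 hne
      (Ideal.pow_le_pow_right (by omega) hαn) (Ideal.pow_le_pow_right (by omega) hαvbar))
  have hunit : ¬ IsUnit α := by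
    intro hu
    rcases units_eq_one_or_eq_neg_one_of_natCard_eq_two hunits hu.unit with h | h
    · have h' : α = 1 := by rw [← hu.unit_spec, h, Units.val_one]
      exact hαn' (by rw [h', sub_self]; exact Ideal.zero_mem _)
    · have h' : α = -1 := by rw [← hu.unit_spec, h, Units.val_neg, Units.val_one]
      apply h2v
      have h'' : (2 : 𝓞 K) = -(α - 1) := by rw [h']; ring
      rw [h'', neg_mem_iff]
      exact Ideal.pow_le_pow_right (by omega) hαn
  have hσα0 : σ • α ≠ 0 := fun h ↦ hα0 (by
    have := congrArg (fun x ↦ σ • x) h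
    rwa [smul_smul, hσσ, one_smul, smul_zero] at this)
  have hσαv' : σ • α ∉ v.asIdeal := fun h ↦ v.isPrime.ne_top ((Ideal.eq_top_iff_one _).mpr (by
    have h1 := v.asIdeal.sub_mem h (Ideal.pow_le_self (by omega) hσαv)
    rwa [sub_sub_cancel] at h1))
  refine ⟨α, hα0, hαv, hσα0, hσαv', hmem𝔣 _ hα𝔤 (Ideal.pow_le_pow_right (by omega) hαvbar),
    hmem𝔣 _ hσα𝔤 (Ideal.pow_le_pow_right (by omega) hσαvbar), hαn, hαn',
    Ideal.pow_le_pow_right (by omega) hσαv, hN, hpos, h4, two_le_absNorm_span_singleton hα0 hunit,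
    fun k hk h ↦ ?_⟩
  refine pow_smul_ne_pow hunits hσ' h2v (n := m + 2) (by omega) (Ideal.pow_le_pow_right (by omega) hαn)
    hαvbar hαn' hk ?_
  have hinj := (algebraMap K (v.adicCompletion K)).injective
  apply hinj
  rw [map_pow, map_pow, HeightOneSpectrum.algebraMap_adicCompletion]
  simpa only [Function.comp_apply, Algebra.algebraMap_self, RingHom.id_apply] using h

/-- The same with the automorphism CHOSEN (`exists_algEquiv_smul_eq`): an `∃ σ α` form.
[cite: deShalit1987, II.4.12 (p. 66–68), II.4.17 (p. 77–78)] -/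
theorem exists_algEquiv_twisterPair (hK2 : Module.finrank ℚ K = 2) [IsTotallyComplex K]
    (hunits : Nat.card (𝓞 K)ˣ = 2) {v vbar : HeightOneSpectrum (𝓞 K)}
    (hv : ((2 : ℕ) : 𝓞 K) ∈ v.asIdeal) (hvbar : ((2 : ℕ) : 𝓞 K) ∈ vbar.asIdeal)
    (h2 : Ideal.span {(2 : 𝓞 K)} = v.asIdeal * vbar.asIdeal) (hne : vbar ≠ v) {𝔤 : Ideal (𝓞 K)}
    (h𝔤v : ¬ 𝔤 ≤ v.asIdeal) (h𝔤vbar : ¬ 𝔤 ≤ vbar.asIdeal) (m : ℕ) :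
    ∃ (σ : K ≃ₐ[ℚ] K) (α : 𝓞 K), σ • v.asIdeal = vbar.asIdeal ∧ σ • vbar.asIdeal = v.asIdeal ∧
      α ≠ 0 ∧ α ∉ v.asIdeal ∧ σ • α ≠ 0 ∧ σ • α ∉ v.asIdeal ∧
      α - 1 ∈ 𝔤 ^ (m + 1) * vbar.asIdeal ^ (m + 1) ∧
      σ • α - 1 ∈ 𝔤 ^ (m + 1) * vbar.asIdeal ^ (m + 1) ∧
      α - 1 ∈ v.asIdeal ^ (m + 2) ∧ α - 1 ∉ v.asIdeal ^ (m + 3) ∧ σ • α - 1 ∈ v.asIdeal ^ (m + 2) ∧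
      Algebra.norm ℤ (σ • α) = Algebra.norm ℤ α ∧ 0 < Algebra.norm ℤ α ∧
      (4 : ℤ) ∣ Algebra.norm ℤ α - 1 ∧ 2 ≤ Ideal.absNorm (Ideal.span {α}) ∧
      ∀ k : ℕ, 0 < k →
        (((σ • α : 𝓞 K) : K) : v.adicCompletion K) ^ k ≠ (((α : 𝓞 K) : K) : v.adicCompletion K) ^ k := by
  haveI : Algebra.IsQuadraticExtension ℚ K := ⟨hK2⟩
  obtain ⟨σ, hσ⟩ := exists_algEquiv_smul_eq Nat.prime_two hv hvbar
  obtain ⟨α, h⟩ := exists_twisterPair hK2 hunits h2 hne hσ h𝔤v h𝔤vbar m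
  exact ⟨σ, α, hσ, (algEquiv_swap_spec hK2 hne hσ).2.2, h⟩

end Literature.NumberTheory.NumberFields

end
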